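import Summits.Ventures.AbcSig.Rows.TemplateC2a

/-!
# Venture AbcSig — CLASS TEMPLATES for census line C2b: `xⁿ + 2^a p^i q^j yⁿ = z²` by the 2-adic class of `a`

HONEST FRAMING. Fully PROVED template theorems of a COMPUTATION cell (`pub-abcsig`); CONDITIONAL on named
hypotheses, no claim on ABC or any summit. Same shape as `Rows/TemplateC2a.lean` with the odd part of `B` a product
of two distinct odd prime powers `p^i q^j` (`i, j ≥ 1`, `a, i, j < n` so that `B` is `n`-th-power free [BS04, p. 29]);
the odd part of every level is `p·q` ([BS04, Lemma 3.2]: `∏_{q | AB} q`). Classes and levels: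
`a = 0`: `32pq`, `2pq` · `a = 1`: `128pq`, `2pq` · `a = 2`: `4pq`, `8pq`, `2pq` · `a = 3`: `32pq`, `2pq` ·
`a ∈ {4,5}`: `8pq`, `2pq` · `a = 6`: `pq`, `2pq` · `a ≥ 7`: `2pq`. Hypotheses per level as in C2a (the output shape of
`Levels/N….lean`'s `levelN_sieve`, with `X o = Excludes M N o (famB B n (fun _ _ => True))`).
Reference: [BS04] Bennett–Skinner, Canad. J. Math. 56 (2004), Lemma 2.1, 3.2, 3.3 (cf. their Thm. 1.5).
-/

namespace Summit.Ventures.AbcSig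

/-- For distinct odd primes `p, q`, `i, j ≥ 1`, `n ∉ {p, q}`: the odd part of the level for `B = 2^a p^i q^j` is
`p·q` (both coefficient orders). -/
theorem bs04OddLevel_twoPow_twoPrimes (p q a i j n : ℕ) (hp : p.Prime) (hq : q.Prime) (hp2 : p ≠ 2) (hq2 : q ≠ 2)
    (hpq : p ≠ q) (hi : 1 ≤ i) (hj : 1 ≤ j) (hnp : n ≠ p) (hnq : n ≠ q) :
    bs04OddLevel 1 (2 ^ a * (p ^ i * q ^ j)) 1 n = p * q ∧ bs04OddLevel (2 ^ a * (p ^ i * q ^ j)) 1 1 n = p * q := by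
  have hB0 : 2 ^ a * (p ^ i * q ^ j) ≠ 0 :=
    mul_ne_zero (pow_ne_zero _ two_ne_zero) (mul_ne_zero (pow_ne_zero _ hp.ne_zero) (pow_ne_zero _ hq.ne_zero))
  have hfilt : (2 ^ a * (p ^ i * q ^ j)).primeFactors.filter (fun r => r ≠ 2 ∧ r ≠ n) = {p, q} := by
    ext r
    simp only [Finset.mem_filter, Nat.mem_primeFactors, Finset.mem_insert, Finset.mem_singleton]
    constructor
    · rintro ⟨⟨hr, hrd, -⟩, hr2, -⟩
      have hcop : Nat.Coprime r (2 ^ a) :=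
        Nat.Coprime.pow_right a ((Nat.coprime_primes hr Nat.prime_two).mpr hr2)
      have h1 : r ∣ p ^ i * q ^ j := hcop.dvd_of_dvd_mul_left hrd
      rcases (Nat.Prime.dvd_mul hr).mp h1 with h | h
      · exact Or.inl ((Nat.prime_dvd_prime_iff_eq hr hp).mp (hr.dvd_of_dvd_pow h))
      · exact Or.inr ((Nat.prime_dvd_prime_iff_eq hr hq).mp (hr.dvd_of_dvd_pow h))
    · rintro (rfl | rfl)
      · exact ⟨⟨hp, Dvd.dvd.mul_left (Dvd.dvd.mul_right (dvd_pow_self r (by omega)) _) _, hB0⟩, hp2,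
          fun h => hnp h.symm⟩
      · exact ⟨⟨hq, Dvd.dvd.mul_left (Dvd.dvd.mul_left (dvd_pow_self r (by omega)) _) _, hB0⟩, hq2,
          fun h => hnq h.symm⟩
  refine ⟨?_, ?_⟩
  · simp only [bs04OddLevel, Nat.primeFactors_one, Finset.filter_empty, Finset.prod_empty, one_mul, hfilt,
      Finset.prod_pair hpq]
  · simp only [bs04OddLevel, Nat.primeFactors_one, Finset.filter_empty, Finset.prod_empty, mul_one, one_mul, hfilt,
      Finset.prod_pair hpq]

/-- The numeric levels for `B = 2^a p^i q^j` in each case. -/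
theorem levelsC2b (p q : ℕ) (hp : p.Prime) (hq : q.Prime) (hp2 : p ≠ 2) (hq2 : q ≠ 2) (hpq : p ≠ q) (n : ℕ)
    (hnp : n ≠ p) (hnq : n ≠ q) (a i j : ℕ) (hi : 1 ≤ i) (hj : 1 ≤ j) :
    bs04Level .v₇ 1 (2 ^ a * (p ^ i * q ^ j)) 1 n = 2 * (p * q) ∧ bs04Level .v₆ 1 (2 ^ a * (p ^ i * q ^ j)) 1 n = p * q ∧
    bs04Level .iv₄₅ 1 (2 ^ a * (p ^ i * q ^ j)) 1 n = 8 * (p * q) ∧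
    bs04Level .iv₃ 1 (2 ^ a * (p ^ i * q ^ j)) 1 n = 32 * (p * q) ∧
    bs04Level .iii₁ 1 (2 ^ a * (p ^ i * q ^ j)) 1 n = 4 * (p * q) ∧
    bs04Level .iii₂ 1 (2 ^ a * (p ^ i * q ^ j)) 1 n = 8 * (p * q) ∧
    bs04Level .iiB 1 (2 ^ a * (p ^ i * q ^ j)) 1 n = 128 * (p * q) ∧
    bs04Level .i 1 (2 ^ a * (p ^ i * q ^ j)) 1 n = 32 * (p * q) ∧
    bs04Level .i (2 ^ a * (p ^ i * q ^ j)) 1 1 n = 32 * (p * q) ∧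
    bs04Level .v₇ (2 ^ a * (p ^ i * q ^ j)) 1 1 n = 2 * (p * q) := by
  obtain ⟨h1, h2⟩ := bs04OddLevel_twoPow_twoPrimes p q a i j n hp hq hp2 hq2 hpq hi hj hnp hnq
  simp only [bs04Level, FreyCase.twoExp, h1, h2]
  norm_num

/-- `B = 2^a p^i q^j` with `a, i, j < n` is `n`-th-power free. -/
theorem nthPowerFree_twoPow_twoPrimes (p q a i j n : ℕ) (hp : p.Prime) (hq : q.Prime) (hp2 : p ≠ 2) (hq2 : q ≠ 2)
    (hpq : p ≠ q) (ha : a < n) (hi : i < n) (hj : j < n) :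
    ∀ r : ℕ, r.Prime → ¬ r ^ n ∣ 2 ^ a * (p ^ i * q ^ j) := by
  intro r hr hdvd
  have key : ∀ (s : ℕ) (k : ℕ) (X : ℕ), s.Prime → k < n → Nat.Coprime (s ^ n) X → s ^ n ∣ s ^ k * X → False := by
    intro s k X hs hk hcop h
    have h1 : s ^ n ∣ s ^ k := hcop.dvd_of_dvd_mul_right h
    have := (Nat.pow_dvd_pow_iff_le_right hs.one_lt).mp h1
    omega
  by_cases hr2 : r = 2
  · subst hr2
    refine key 2 a (p ^ i * q ^ j) Nat.prime_two ha ?_ hdvd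
    exact Nat.Coprime.pow_left _ (Nat.Coprime.mul_right
      (Nat.Coprime.pow_right _ ((Nat.coprime_primes Nat.prime_two hp).mpr (Ne.symm hp2)))
      (Nat.Coprime.pow_right _ ((Nat.coprime_primes Nat.prime_two hq).mpr (Ne.symm hq2))))
  · have hcop2 : Nat.Coprime (r ^ n) (2 ^ a) :=
      Nat.Coprime.pow _ _ ((Nat.coprime_primes hr Nat.prime_two).mpr hr2)
    have h1 : r ^ n ∣ p ^ i * q ^ j := hcop2.dvd_of_dvd_mul_left hdvd
    by_cases hrp : r = p
    · subst hrp
      refine key r i (q ^ j) hr hi ?_ h1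
      exact Nat.Coprime.pow _ _ ((Nat.coprime_primes hr hq).mpr hpq)
    · have hcopp : Nat.Coprime (r ^ n) (p ^ i) := Nat.Coprime.pow _ _ ((Nat.coprime_primes hr hp).mpr hrp)
      have h2 : r ^ n ∣ q ^ j := hcopp.dvd_of_dvd_mul_left h1
      have hrq : r = q :=
        (Nat.prime_dvd_prime_iff_eq hr hq).mp (hr.dvd_of_dvd_pow ((dvd_pow_self r (by omega)).trans h2))
      subst hrq
      have h3 : r ^ n ∣ r ^ j * 1 := by simpa using h2
      exact key r j 1 hr hj (Nat.coprime_one_right _) h3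

/-- A prime `n ∉ {2, p, q}` does not divide `2^a p^i q^j`. -/
theorem not_dvd_twoPow_twoPrimes (p q a i j n : ℕ) (hp : p.Prime) (hq : q.Prime) (hn : n.Prime) (hn2 : n ≠ 2)
    (hnp : n ≠ p) (hnq : n ≠ q) : ¬ n ∣ 2 ^ a * (p ^ i * q ^ j) := by
  intro h
  rcases (Nat.Prime.dvd_mul hn).mp h with h | h
  · exact hn2 ((Nat.prime_dvd_prime_iff_eq hn Nat.prime_two).mp (hn.dvd_of_dvd_pow h))
  · rcases (Nat.Prime.dvd_mul hn).mp h with h | h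
    · exact hnp ((Nat.prime_dvd_prime_iff_eq hn hp).mp (hn.dvd_of_dvd_pow h))
    · exact hnq ((Nat.prime_dvd_prime_iff_eq hn hq).mp (hn.dvd_of_dvd_pow h))

/-- **Class `a ≥ 7`** (level `2pq` only). -/
theorem rowC2b_age7 (p q : ℕ) (hp : p.Prime) (hq : q.Prime) (hp2 : p ≠ 2) (hq2 : q ≠ 2) (hpq : p ≠ q)
    (M : NewformModel) (hP : M.BS04Package) (n : ℕ) (hn : n.Prime) (h7 : 7 ≤ n) (hnp : n ≠ p) (hnq : n ≠ q) {orbs2 : List OrbitData} (hD2 : M.DataComplete (2 * (p * q)) orbs2) (a i j : ℕ) (ha : 7 ≤ a)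
    (hi : 1 ≤ i) (hj : 1 ≤ j) (han : a < n) (hin : i < n) (hjn : j < n)
    (hS2 : ∀ o ∈ orbs2, (∀ e ∈ o.coeffs, e.ell.Prime ∧ e.ell ≠ 2 ∧ ¬ e.ell ∣ 2 * (p * q)) ∧
      (o.Eliminated bs04Allowed n ∨ M.Excludes (2 * (p * q)) o (famB (2 ^ a * (p ^ i * q ^ j)) n (fun _ _ => True))))
    (x y z : ℤ) (hxy1 : x * y ≠ 1) (hxy2 : x * y ≠ -1) : ¬ IsPrimitiveSolution 1 (2 ^ a * (p ^ i * q ^ j)) 1 n x y z := by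
  have hB : 0 < 2 ^ a * (p ^ i * q ^ j) := by have := hp.pos; have := hq.pos; positivity
  have hnB := not_dvd_twoPow_twoPrimes p q a i j n hp hq hn (by omega) hnp hnq
  have hfreeB := nthPowerFree_twoPow_twoPrimes p q a i j n hp hq hp2 hq2 hpq han hin hjn
  have hL := (levelsC2b p q hp hq hp2 hq2 hpq n hnp hnq a i j hi hj).1
  have hv : (2 : ℤ) ^ 7 ∣ ((2 ^ a * (p ^ i * q ^ j) : ℕ) : ℤ) * y ^ n := by
    have : (2 : ℕ) ^ 7 ∣ 2 ^ a * (p ^ i * q ^ j) := Dvd.dvd.mul_right (pow_dvd_pow 2 ha) _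
    have h' : (2 : ℤ) ^ 7 ∣ ((2 ^ a * (p ^ i * q ^ j) : ℕ) : ℤ) := by exact_mod_cast this
    exact h'.mul_right _
  exact branch_v7 _ hB M hP n hn h7 hnB hfreeB (2 * (p * q)) hL (fun _ _ => True) hD2 hS2 x y z trivial hv hxy1 hxy2

/-- **Class `a = 6`** (levels `pq` for `xy` odd, `2pq` for `y` even). -/
theorem rowC2b_a6 (p q : ℕ) (hp : p.Prime) (hq : q.Prime) (hp2 : p ≠ 2) (hq2 : q ≠ 2) (hpq : p ≠ q)
    (M : NewformModel) (hP : M.BS04Package) (n : ℕ) (hn : n.Prime) (h7 : 7 ≤ n) (hnp : n ≠ p) (hnq : n ≠ q) {orbs1 orbs2 : List OrbitData} (hD1 : M.DataComplete (p * q) orbs1)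
    (hD2 : M.DataComplete (2 * (p * q)) orbs2) (i j : ℕ) (hi : 1 ≤ i) (hj : 1 ≤ j) (hin : i < n) (hjn : j < n)
    (hS1 : ∀ o ∈ orbs1, (∀ e ∈ o.coeffs, e.ell.Prime ∧ e.ell ≠ 2 ∧ ¬ e.ell ∣ p * q) ∧
      (o.Eliminated bs04Allowed n ∨ M.Excludes (p * q) o (famB (2 ^ 6 * (p ^ i * q ^ j)) n (fun _ _ => True))))
    (hS2 : ∀ o ∈ orbs2, (∀ e ∈ o.coeffs, e.ell.Prime ∧ e.ell ≠ 2 ∧ ¬ e.ell ∣ 2 * (p * q)) ∧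
      (o.Eliminated bs04Allowed n ∨ M.Excludes (2 * (p * q)) o (famB (2 ^ 6 * (p ^ i * q ^ j)) n (fun _ _ => True))))
    (x y z : ℤ) (hxy1 : x * y ≠ 1) (hxy2 : x * y ≠ -1) : ¬ IsPrimitiveSolution 1 (2 ^ 6 * (p ^ i * q ^ j)) 1 n x y z := by
  intro hsol
  have hB : 0 < 2 ^ 6 * (p ^ i * q ^ j) := by have := hp.pos; have := hq.pos; positivity
  have hnB := not_dvd_twoPow_twoPrimes p q 6 i j n hp hq hn (by omega) hnp hnq
  have hfreeB := nthPowerFree_twoPow_twoPrimes p q 6 i j n hp hq hp2 hq2 hpq (by omega) hin hjn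
  obtain ⟨hL2, hL1, -⟩ := levelsC2b p q hp hq hp2 hq2 hpq n hnp hnq 6 i j hi hj
  have hLodd : ¬ 2 ∣ ((p : ℤ) ^ i * (q : ℤ) ^ j) :=
    not_two_dvd_mul (not_two_dvd_pow (prime_odd_int p hp hp2) i) (not_two_dvd_pow (prime_odd_int q hq hq2) j)
  by_cases hy : 2 ∣ y
  · have hv : (2 : ℤ) ^ 7 ∣ ((2 ^ 6 * (p ^ i * q ^ j) : ℕ) : ℤ) * y ^ n :=
      Dvd.dvd.mul_left ((pow_dvd_pow 2 h7).trans (pow_dvd_pow_of_dvd hy n)) _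
    exact branch_v7 _ hB M hP n hn h7 hnB hfreeB (2 * (p * q)) hL2 (fun _ _ => True) hD2 hS2 x y z trivial hv hxy1 hxy2
      hsol
  · have hv : OrdTwoEq (((2 ^ 6 * (p ^ i * q ^ j) : ℕ) : ℤ) * y ^ n) 6 := by
      have : ((2 ^ 6 * (p ^ i * q ^ j) : ℕ) : ℤ) * y ^ n = 2 ^ 6 * (((p : ℤ) ^ i * (q : ℤ) ^ j) * y ^ n) := by push_cast; ring
      rw [this]
      exact ordTwoEq_twoPow_mul_odd 6 _ (not_two_dvd_mul hLodd (not_two_dvd_pow hy n))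
    exact branch_v6 _ hB M hP n hn h7 hnB hfreeB (p * q) hL1 (fun _ _ => True) hD1 hS1 x y z trivial hv hxy1 hxy2 hsol

/-- Shared shape of the classes `a ∈ {1, 2, 3, 4, 5}`: `x` is odd; `y` even goes to level `2pq` by (v₇). This lemma
isolates the `y`-even half. -/
theorem rowC2b_yeven (p q : ℕ) (hp : p.Prime) (hq : q.Prime) (hp2 : p ≠ 2) (hq2 : q ≠ 2) (hpq : p ≠ q)
    (M : NewformModel) (hP : M.BS04Package) (n : ℕ) (hn : n.Prime) (h7 : 7 ≤ n) (hnp : n ≠ p) (hnq : n ≠ q) {orbs2 : List OrbitData} (hD2 : M.DataComplete (2 * (p * q)) orbs2) (a i j : ℕ) (hi : 1 ≤ i) (hj : 1 ≤ j)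
    (han : a < n) (hin : i < n) (hjn : j < n)
    (hS2 : ∀ o ∈ orbs2, (∀ e ∈ o.coeffs, e.ell.Prime ∧ e.ell ≠ 2 ∧ ¬ e.ell ∣ 2 * (p * q)) ∧
      (o.Eliminated bs04Allowed n ∨ M.Excludes (2 * (p * q)) o (famB (2 ^ a * (p ^ i * q ^ j)) n (fun _ _ => True))))
    (x y z : ℤ) (hy : 2 ∣ y) (hxy1 : x * y ≠ 1) (hxy2 : x * y ≠ -1) :
    ¬ IsPrimitiveSolution 1 (2 ^ a * (p ^ i * q ^ j)) 1 n x y z := by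
  have hB : 0 < 2 ^ a * (p ^ i * q ^ j) := by have := hp.pos; have := hq.pos; positivity
  have hnB := not_dvd_twoPow_twoPrimes p q a i j n hp hq hn (by omega) hnp hnq
  have hfreeB := nthPowerFree_twoPow_twoPrimes p q a i j n hp hq hp2 hq2 hpq han hin hjn
  have hL := (levelsC2b p q hp hq hp2 hq2 hpq n hnp hnq a i j hi hj).1
  have hv : (2 : ℤ) ^ 7 ∣ ((2 ^ a * (p ^ i * q ^ j) : ℕ) : ℤ) * y ^ n :=
    Dvd.dvd.mul_left ((pow_dvd_pow 2 h7).trans (pow_dvd_pow_of_dvd hy n)) _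
  exact branch_v7 _ hB M hP n hn h7 hnB hfreeB (2 * (p * q)) hL (fun _ _ => True) hD2 hS2 x y z trivial hv hxy1 hxy2

/-- **Class `a ∈ {4, 5}`** (levels `8pq` for `xy` odd, `2pq` for `y` even). -/
theorem rowC2b_a45 (p q : ℕ) (hp : p.Prime) (hq : q.Prime) (hp2 : p ≠ 2) (hq2 : q ≠ 2) (hpq : p ≠ q)
    (M : NewformModel) (hP : M.BS04Package) (n : ℕ) (hn : n.Prime) (h7 : 7 ≤ n) (hnp : n ≠ p) (hnq : n ≠ q) {orbs8 orbs2 : List OrbitData} (hD8 : M.DataComplete (8 * (p * q)) orbs8)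
    (hD2 : M.DataComplete (2 * (p * q)) orbs2) (a i j : ℕ) (ha : a = 4 ∨ a = 5) (hi : 1 ≤ i) (hj : 1 ≤ j) (han : a < n)
    (hin : i < n) (hjn : j < n)
    (hS8 : ∀ o ∈ orbs8, (∀ e ∈ o.coeffs, e.ell.Prime ∧ e.ell ≠ 2 ∧ ¬ e.ell ∣ 8 * (p * q)) ∧
      (o.Eliminated bs04Allowed n ∨ M.Excludes (8 * (p * q)) o (famB (2 ^ a * (p ^ i * q ^ j)) n (fun _ _ => True))))
    (hS2 : ∀ o ∈ orbs2, (∀ e ∈ o.coeffs, e.ell.Prime ∧ e.ell ≠ 2 ∧ ¬ e.ell ∣ 2 * (p * q)) ∧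
      (o.Eliminated bs04Allowed n ∨ M.Excludes (2 * (p * q)) o (famB (2 ^ a * (p ^ i * q ^ j)) n (fun _ _ => True))))
    (x y z : ℤ) (hxy1 : x * y ≠ 1) (hxy2 : x * y ≠ -1) : ¬ IsPrimitiveSolution 1 (2 ^ a * (p ^ i * q ^ j)) 1 n x y z := by
  intro hsol
  by_cases hy : 2 ∣ y
  · exact rowC2b_yeven p q hp hq hp2 hq2 hpq M hP n hn h7 hnp hnq hD2 a i j hi hj han hin hjn hS2 x y z hy hxy1 hxy2 hsol
  have hB : 0 < 2 ^ a * (p ^ i * q ^ j) := by have := hp.pos; have := hq.pos; positivity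
  have hnB := not_dvd_twoPow_twoPrimes p q a i j n hp hq hn (by omega) hnp hnq
  have hfreeB := nthPowerFree_twoPow_twoPrimes p q a i j n hp hq hp2 hq2 hpq han hin hjn
  obtain ⟨-, -, hL8, -⟩ := levelsC2b p q hp hq hp2 hq2 hpq n hnp hnq a i j hi hj
  have hLodd : ¬ 2 ∣ ((p : ℤ) ^ i * (q : ℤ) ^ j) :=
    not_two_dvd_mul (not_two_dvd_pow (prime_odd_int p hp hp2) i) (not_two_dvd_pow (prime_odd_int q hq hq2) j)
  have hBeven : 2 ∣ ((2 ^ a * (p ^ i * q ^ j) : ℕ) : ℤ) := by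
    have : (2 : ℕ) ∣ 2 ^ a * (p ^ i * q ^ j) := Dvd.dvd.mul_right (dvd_pow_self 2 (by omega)) _
    exact_mod_cast this
  have hx := odd_x_of_even_B hsol hBeven
  have hxy : ¬ 2 ∣ x * y := not_two_dvd_mul hx hy
  have hB45 : OrdTwoEq ((2 ^ a * (p ^ i * q ^ j) : ℕ) : ℤ) 4 ∨ OrdTwoEq ((2 ^ a * (p ^ i * q ^ j) : ℕ) : ℤ) 5 := by
    rcases ha with rfl | rfl
    · left; push_cast; exact ordTwoEq_twoPow_mul_odd 4 _ hLodd
    · right; push_cast; exact ordTwoEq_twoPow_mul_odd 5 _ hLodd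
  exact branch_iv45 _ hB M hP n hn h7 hnB hfreeB (8 * (p * q)) hL8 (fun _ _ => True) hD8 hS8 x y z trivial hB45 hxy hxy1
    hxy2 hsol

/-- **Class `a = 3`** (levels `32pq` for `xy` odd, `2pq` for `y` even). -/
theorem rowC2b_a3 (p q : ℕ) (hp : p.Prime) (hq : q.Prime) (hp2 : p ≠ 2) (hq2 : q ≠ 2) (hpq : p ≠ q)
    (M : NewformModel) (hP : M.BS04Package) (n : ℕ) (hn : n.Prime) (h7 : 7 ≤ n) (hnp : n ≠ p) (hnq : n ≠ q) {orbs32 orbs2 : List OrbitData} (hD32 : M.DataComplete (32 * (p * q)) orbs32)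
    (hD2 : M.DataComplete (2 * (p * q)) orbs2) (i j : ℕ) (hi : 1 ≤ i) (hj : 1 ≤ j) (hin : i < n) (hjn : j < n)
    (hS32 : ∀ o ∈ orbs32, (∀ e ∈ o.coeffs, e.ell.Prime ∧ e.ell ≠ 2 ∧ ¬ e.ell ∣ 32 * (p * q)) ∧
      (o.Eliminated bs04Allowed n ∨ M.Excludes (32 * (p * q)) o (famB (2 ^ 3 * (p ^ i * q ^ j)) n (fun _ _ => True))))
    (hS2 : ∀ o ∈ orbs2, (∀ e ∈ o.coeffs, e.ell.Prime ∧ e.ell ≠ 2 ∧ ¬ e.ell ∣ 2 * (p * q)) ∧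
      (o.Eliminated bs04Allowed n ∨ M.Excludes (2 * (p * q)) o (famB (2 ^ 3 * (p ^ i * q ^ j)) n (fun _ _ => True))))
    (x y z : ℤ) (hxy1 : x * y ≠ 1) (hxy2 : x * y ≠ -1) : ¬ IsPrimitiveSolution 1 (2 ^ 3 * (p ^ i * q ^ j)) 1 n x y z := by
  intro hsol
  by_cases hy : 2 ∣ y
  · exact rowC2b_yeven p q hp hq hp2 hq2 hpq M hP n hn h7 hnp hnq hD2 3 i j hi hj (by omega) hin hjn hS2 x y z hy hxy1 hxy2 hsol
  have hB : 0 < 2 ^ 3 * (p ^ i * q ^ j) := by have := hp.pos; have := hq.pos; positivity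
  have hnB := not_dvd_twoPow_twoPrimes p q 3 i j n hp hq hn (by omega) hnp hnq
  have hfreeB := nthPowerFree_twoPow_twoPrimes p q 3 i j n hp hq hp2 hq2 hpq (by omega) hin hjn
  obtain ⟨-, -, -, hL32, -⟩ := levelsC2b p q hp hq hp2 hq2 hpq n hnp hnq 3 i j hi hj
  have hLodd : ¬ 2 ∣ ((p : ℤ) ^ i * (q : ℤ) ^ j) :=
    not_two_dvd_mul (not_two_dvd_pow (prime_odd_int p hp hp2) i) (not_two_dvd_pow (prime_odd_int q hq hq2) j)
  have hBeven : 2 ∣ ((2 ^ 3 * (p ^ i * q ^ j) : ℕ) : ℤ) := by push_cast; exact Dvd.dvd.mul_right ⟨4, by norm_num⟩ _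
  have hx := odd_x_of_even_B hsol hBeven
  have hxy : ¬ 2 ∣ x * y := not_two_dvd_mul hx hy
  have hB3 : OrdTwoEq ((2 ^ 3 * (p ^ i * q ^ j) : ℕ) : ℤ) 3 := by
    push_cast; exact ordTwoEq_twoPow_mul_odd 3 _ hLodd
  exact branch_iv3 _ hB M hP n hn h7 hnB hfreeB (32 * (p * q)) hL32 (fun _ _ => True) hD32 hS32 x y z trivial hB3 hxy
    hxy1 hxy2 hsol

/-- **Class `a = 2`** (levels `4pq` and `8pq` for `xy` odd, `2pq` for `y` even). -/
theorem rowC2b_a2 (p q : ℕ) (hp : p.Prime) (hq : q.Prime) (hp2 : p ≠ 2) (hq2 : q ≠ 2) (hpq : p ≠ q)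
    (M : NewformModel) (hP : M.BS04Package) (n : ℕ) (hn : n.Prime) (h7 : 7 ≤ n) (hnp : n ≠ p) (hnq : n ≠ q) {orbs4 orbs8 orbs2 : List OrbitData} (hD4 : M.DataComplete (4 * (p * q)) orbs4)
    (hD8 : M.DataComplete (8 * (p * q)) orbs8) (hD2 : M.DataComplete (2 * (p * q)) orbs2) (i j : ℕ) (hi : 1 ≤ i) (hj : 1 ≤ j)
    (hin : i < n) (hjn : j < n)
    (hS4 : ∀ o ∈ orbs4, (∀ e ∈ o.coeffs, e.ell.Prime ∧ e.ell ≠ 2 ∧ ¬ e.ell ∣ 4 * (p * q)) ∧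
      (o.Eliminated bs04Allowed n ∨ M.Excludes (4 * (p * q)) o (famB (2 ^ 2 * (p ^ i * q ^ j)) n (fun _ _ => True))))
    (hS8 : ∀ o ∈ orbs8, (∀ e ∈ o.coeffs, e.ell.Prime ∧ e.ell ≠ 2 ∧ ¬ e.ell ∣ 8 * (p * q)) ∧
      (o.Eliminated bs04Allowed n ∨ M.Excludes (8 * (p * q)) o (famB (2 ^ 2 * (p ^ i * q ^ j)) n (fun _ _ => True))))
    (hS2 : ∀ o ∈ orbs2, (∀ e ∈ o.coeffs, e.ell.Prime ∧ e.ell ≠ 2 ∧ ¬ e.ell ∣ 2 * (p * q)) ∧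
      (o.Eliminated bs04Allowed n ∨ M.Excludes (2 * (p * q)) o (famB (2 ^ 2 * (p ^ i * q ^ j)) n (fun _ _ => True))))
    (x y z : ℤ) (hxy1 : x * y ≠ 1) (hxy2 : x * y ≠ -1) : ¬ IsPrimitiveSolution 1 (2 ^ 2 * (p ^ i * q ^ j)) 1 n x y z := by
  intro hsol
  by_cases hy : 2 ∣ y
  · exact rowC2b_yeven p q hp hq hp2 hq2 hpq M hP n hn h7 hnp hnq hD2 2 i j hi hj (by omega) hin hjn hS2 x y z hy hxy1 hxy2 hsol
  have hB : 0 < 2 ^ 2 * (p ^ i * q ^ j) := by have := hp.pos; have := hq.pos; positivity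
  have hnB := not_dvd_twoPow_twoPrimes p q 2 i j n hp hq hn (by omega) hnp hnq
  have hfreeB := nthPowerFree_twoPow_twoPrimes p q 2 i j n hp hq hp2 hq2 hpq (by omega) hin hjn
  obtain ⟨-, -, -, -, hL4, hL8, -⟩ := levelsC2b p q hp hq hp2 hq2 hpq n hnp hnq 2 i j hi hj
  have hLodd : ¬ 2 ∣ ((p : ℤ) ^ i * (q : ℤ) ^ j) :=
    not_two_dvd_mul (not_two_dvd_pow (prime_odd_int p hp hp2) i) (not_two_dvd_pow (prime_odd_int q hq hq2) j)
  have hBeven : 2 ∣ ((2 ^ 2 * (p ^ i * q ^ j) : ℕ) : ℤ) := by push_cast; exact Dvd.dvd.mul_right ⟨2, by norm_num⟩ _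
  have hx := odd_x_of_even_B hsol hBeven
  have hxy : ¬ 2 ∣ x * y := not_two_dvd_mul hx hy
  have hB2 : OrdTwoEq ((2 ^ 2 * (p ^ i * q ^ j) : ℕ) : ℤ) 2 := by
    push_cast; exact ordTwoEq_twoPow_mul_odd 2 _ hLodd
  exact branch_iii _ hB M hP n hn h7 hnB hfreeB (4 * (p * q)) (8 * (p * q)) hL4 hL8 (fun _ _ => True) hD4 hD8 hS4 hS8 x y z
    trivial hB2 hxy hxy1 hxy2 hsol

/-- **Class `a = 1`** (levels `128pq` for `xy` odd, `2pq` for `y` even). -/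
theorem rowC2b_a1 (p q : ℕ) (hp : p.Prime) (hq : q.Prime) (hp2 : p ≠ 2) (hq2 : q ≠ 2) (hpq : p ≠ q)
    (M : NewformModel) (hP : M.BS04Package) (n : ℕ) (hn : n.Prime) (h7 : 7 ≤ n) (hnp : n ≠ p) (hnq : n ≠ q) {orbs128 orbs2 : List OrbitData} (hD128 : M.DataComplete (128 * (p * q)) orbs128)
    (hD2 : M.DataComplete (2 * (p * q)) orbs2) (i j : ℕ) (hi : 1 ≤ i) (hj : 1 ≤ j) (hin : i < n) (hjn : j < n)
    (hS128 : ∀ o ∈ orbs128, (∀ e ∈ o.coeffs, e.ell.Prime ∧ e.ell ≠ 2 ∧ ¬ e.ell ∣ 128 * (p * q)) ∧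
      (o.Eliminated bs04Allowed n ∨ M.Excludes (128 * (p * q)) o (famB (2 ^ 1 * (p ^ i * q ^ j)) n (fun _ _ => True))))
    (hS2 : ∀ o ∈ orbs2, (∀ e ∈ o.coeffs, e.ell.Prime ∧ e.ell ≠ 2 ∧ ¬ e.ell ∣ 2 * (p * q)) ∧
      (o.Eliminated bs04Allowed n ∨ M.Excludes (2 * (p * q)) o (famB (2 ^ 1 * (p ^ i * q ^ j)) n (fun _ _ => True))))
    (x y z : ℤ) (hxy1 : x * y ≠ 1) (hxy2 : x * y ≠ -1) : ¬ IsPrimitiveSolution 1 (2 ^ 1 * (p ^ i * q ^ j)) 1 n x y z := by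
  intro hsol
  by_cases hy : 2 ∣ y
  · exact rowC2b_yeven p q hp hq hp2 hq2 hpq M hP n hn h7 hnp hnq hD2 1 i j hi hj (by omega) hin hjn hS2 x y z hy hxy1 hxy2 hsol
  have hB : 0 < 2 ^ 1 * (p ^ i * q ^ j) := by have := hp.pos; have := hq.pos; positivity
  have hnB := not_dvd_twoPow_twoPrimes p q 1 i j n hp hq hn (by omega) hnp hnq
  have hfreeB := nthPowerFree_twoPow_twoPrimes p q 1 i j n hp hq hp2 hq2 hpq (by omega) hin hjn
  obtain ⟨-, -, -, -, -, -, hL128, -⟩ := levelsC2b p q hp hq hp2 hq2 hpq n hnp hnq 1 i j hi hj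
  have hLodd : ¬ 2 ∣ ((p : ℤ) ^ i * (q : ℤ) ^ j) :=
    not_two_dvd_mul (not_two_dvd_pow (prime_odd_int p hp hp2) i) (not_two_dvd_pow (prime_odd_int q hq hq2) j)
  have hBeven : 2 ∣ ((2 ^ 1 * (p ^ i * q ^ j) : ℕ) : ℤ) := by push_cast; exact Dvd.dvd.mul_right ⟨1, by norm_num⟩ _
  have hx := odd_x_of_even_B hsol hBeven
  have hxy : ¬ 2 ∣ x * y := not_two_dvd_mul hx hy
  have hB1 : OrdTwoEq ((2 ^ 1 * (p ^ i * q ^ j) : ℕ) : ℤ) 1 := by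
    push_cast; exact ordTwoEq_twoPow_mul_odd 1 _ hLodd
  exact branch_iiB _ hB M hP n hn h7 hnB hfreeB (128 * (p * q)) hL128 (fun _ _ => True) hD128 hS128 x y z trivial hB1
    hxy hxy1 hxy2 hsol

/-- **Class `a = 0`** (`B = p^i q^j` odd; levels `32pq` for `xy` odd, `2pq` for `xy` even). -/
theorem rowC2b_a0 (p q : ℕ) (hp : p.Prime) (hq : q.Prime) (hp2 : p ≠ 2) (hq2 : q ≠ 2) (hpq : p ≠ q)
    (M : NewformModel) (hP : M.BS04Package) (n : ℕ) (hn : n.Prime) (h7 : 7 ≤ n) (hnp : n ≠ p) (hnq : n ≠ q) {orbs32 orbs2 : List OrbitData} (hD32 : M.DataComplete (32 * (p * q)) orbs32)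
    (hD2 : M.DataComplete (2 * (p * q)) orbs2) (i j : ℕ) (hi : 1 ≤ i) (hj : 1 ≤ j) (hin : i < n) (hjn : j < n)
    (hS32 : ∀ o ∈ orbs32, (∀ e ∈ o.coeffs, e.ell.Prime ∧ e.ell ≠ 2 ∧ ¬ e.ell ∣ 32 * (p * q)) ∧
      (o.Eliminated bs04Allowed n ∨ M.Excludes (32 * (p * q)) o (famB (2 ^ 0 * (p ^ i * q ^ j)) n (fun _ _ => True))))
    (hS2 : ∀ o ∈ orbs2, (∀ e ∈ o.coeffs, e.ell.Prime ∧ e.ell ≠ 2 ∧ ¬ e.ell ∣ 2 * (p * q)) ∧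
      (o.Eliminated bs04Allowed n ∨ M.Excludes (2 * (p * q)) o (famB (2 ^ 0 * (p ^ i * q ^ j)) n (fun _ _ => True))))
    (x y z : ℤ) (hxy1 : x * y ≠ 1) (hxy2 : x * y ≠ -1) : ¬ IsPrimitiveSolution 1 (2 ^ 0 * (p ^ i * q ^ j)) 1 n x y z := by
  intro hsol
  have hB : 0 < 2 ^ 0 * (p ^ i * q ^ j) := by have := hp.pos; have := hq.pos; positivity
  have hnB := not_dvd_twoPow_twoPrimes p q 0 i j n hp hq hn (by omega) hnp hnq
  have hfreeB := nthPowerFree_twoPow_twoPrimes p q 0 i j n hp hq hp2 hq2 hpq (by omega) hin hjn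
  obtain ⟨hL2, -, -, -, -, -, -, hL32, hL32', hL2'⟩ := levelsC2b p q hp hq hp2 hq2 hpq n hnp hnq 0 i j hi hj
  have hLodd : ¬ 2 ∣ ((p : ℤ) ^ i * (q : ℤ) ^ j) :=
    not_two_dvd_mul (not_two_dvd_pow (prime_odd_int p hp hp2) i) (not_two_dvd_pow (prime_odd_int q hq hq2) j)
  have hBodd : ¬ 2 ∣ ((2 ^ 0 * (p ^ i * q ^ j) : ℕ) : ℤ) := by
    push_cast; simpa using hLodd
  by_cases hxy : 2 ∣ x * y
  · exact branch_even_Bodd _ hB M hP n hn h7 hnB hfreeB (2 * (p * q)) hL2 hL2' (fun _ _ => True) hD2 hS2 x y z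
      trivial hxy hsol
  · exact branch_i_odd _ hB hBodd M hP n hn h7 hnB hfreeB (32 * (p * q)) hL32 hL32' (fun _ _ => True) hD32 hS32
      x y z trivial hxy hxy1 hxy2 hsol

end Summit.Ventures.AbcSig
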